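import Summits.HodgeConjecture.HodgeConjecture.Theorems.R90S5SplitLabelsEqOfRoutesAt     -- ★ (R90-C131-p02, file 2 (iv-S)) `bc_localComponent_eq_of_routesAt_of_memXiFamily` (+ `_of_hasFinComponent`): routing to `ξ` + `ξ′`-envelope ⇒ `η̃, ψ̃` agree at `splitWitness v`
import Literature.NumberTheory.Rogawski1990.OneDimAutRepHSplitRigidityOffFinite         -- ★ (this seat, p861883) `OneDimAutRepH.ext_of_exists_bc_localComponent_eq_of_split_of_not_mem` (split places OFF A FINITE SET ⇒ `ξ = ξ′`)
import HarnessLib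

/-!
# R90-TF · S5 «Ch. 13.3» · DEAL #10 ROAD S, file 3: THE FAMILY PIN (J-a″) — a discrete `P` ROUTED by `ξ` off a finite set and lying in the `ξ′`-ENVELOPE has `ξ = ξ′`,
# hence lies in the `ξ`-envelope (Rogawski 1990 §13.1 p. 199 «`Π(ξ)` indexed by `ξ`»; Thm. 13.3.4∕13.3.5 p. 202; §4.13 Lemma 4.13.1 (b); Cassels–Fröhlich VII §4 Prop. 4.1)

Cell `hodgecm-mathlib`, programme R90-TF, section S5 (base `R90-C133`), prover seat R90-C133-p02 (g0); R90-C133-plan (g0) DEAL #10 + «(J-a″) ROAD S — GO NOW» (2026-09-04T16:14:29Z):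
file 1 ★ `TorusCharacterSplitRigidityOffFinite` (p861846) + its `OneDimAutRepH` wrappers ★ `OneDimAutRepHSplitRigidityOffFinite` (p861883) = the GLOBAL half from the split places off
a finite set; file 2 ★ `R90S5SplitLabelsEqOfRoutesAt` (R90-C131-p02 (g0), DEAL #15) = the LOCAL split half; THIS file = the assembly, for EVERY hermitian `H` (general inner form).
Crux item `stmt-HodgeConjecture-24833` (h413); `--supports` helper, closes nothing by itself.  PROOF LANE: theorems only (no `def`, no instance, no notation, no `sorry`).

THE MATHEMATICS.  Let `P` be a discrete automorphic representation of `U(H)` which is ROUTED by `ξ` off a finite set `S₁` of finite places of `L⁺` (★ `RoutesAt`: at a split `v ∉ S₁`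
the chosen class `clFinChoice P v` is the member of the D6 split packet of `ξ` at the definite witness `w = splitWitness v`) and which lies in the `ξ′`-ENVELOPE (★ `MemXiFamily P … ξ′`).
At every split `v ∉ S₁` at which `P` has an admissible unitarizable constituent (`(admUnitConstituents P v).Nonempty` — automatic for `P` with an irreducible admissible finite
component, ★ `admUnitConstituents_nonempty_of_hasFinComponent`), the chosen class lies in BOTH singleton split packets at `w`, so the base changes `η̃, ψ̃` of `ξ` and `ξ′` have
the same local component at `w` (file 2, ★ Zelevinsky rigidity of `Ind((ν₀∘det) ⊠ χ′)`); the automorphic characters `η, ψ` of the anisotropic torus `U(1)_{L/L⁺}` are determined by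
these components at one place above every split `v` outside a finite set (file 1: Tate's density with the exceptional set in the weak-approximation set) — so `ξ = ξ′`, and `P` lies in
the `ξ`-envelope.  This is print's «`Π(ξ) ∩ Π(ξ′) = ∅` for `ξ ≠ ξ′`» ∕ Thm. 13.3.5 read for A-packets, WITHOUT the trace formula and WITHOUT any non-split local input.

CONTENTS (V6 frame `(L, H, hH, hHd, μω, hμu, μZ, keys, μ)` of ★ `RoutesAt`):
* §1 `xi_eq_of_routesAt_of_memXiFamily_of_not_mem` — `(∀ v ∉ S₁, RoutesAt … P ξ v) → MemXiFamily P … ξ′ → (∀ v ∉ S₁, (admUnitConstituents P v).Nonempty) → ξ = ξ′`;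
  `…_of_hasFinComponent` (the constituent supply from an irreducible admissible finite component); cofinite-filter form `xi_eq_of_eventually_routesAt_of_memXiFamily_of_hasFinComponent`.
* §2 (J-a″) `memXiFamily_of_routesAt_of_memXiFamily_of_not_mem` ∕ `…_of_hasFinComponent` — same hypotheses ⇒ `MemXiFamily P … ξ` (rewrite along §1).
* §3 the same under the frame's ONE named binder `hAF : UnitaryGroup.AutomorphicFlathAdmissible …` (dealer RULING (AFA-1), as file 2 does): `xi_eq_…_of_automorphicFlathAdmissible`,
  `memXiFamily_…_of_automorphicFlathAdmissible`, and the cofinite-filter form `memXiFamily_of_eventually_routesAt_of_memXiFamily_of_automorphicFlathAdmissible`.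
HONEST LABEL: HC_CM is proved only modulo the 7 printed citations (2 remaining named inputs: hLiu418 = stmt-HodgeConjecture-24832, h413 = stmt-HodgeConjecture-24833) until rung 0
closes; REL ≠ ★ ≠ BUILT — a family-rigidity helper (S7 (J-a″) `SocketQsFamilyPin`, S9 (S-U), cofinite U♭), no leaf moves.

References: [Rogawski1990] §13.1 p. 199; §13.3 Thm. 13.3.4–13.3.5 p. 202; §12.2 pp. 173–174; §4.13 Lemma 4.13.1 (b) p. 62.  [Zelevinsky1980] Thm. 4.2, Thm. 6.1.
[CasselsFrohlichANT1967] Ch. II §6; Ch. VII §4 Prop. 4.1.  [PlatonovRapinchuk1994] §7.3 Prop. 7.8.  [FlathCorvallis1979] Thm. 3.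
-/

set_option autoImplicit false
-- the mandated namespace repeats the single-problem summit's segment (`HodgeConjecture.HodgeConjecture`)
set_option linter.dupNamespace false

noncomputable section

open NumberField IsDedekindDomain MeasureTheory Filter
open Literature.NumberTheory.Rogawski1990 Literature.NumberTheory.GaloisRepresentations
open Literature.NumberTheory.Automorphic Literature.NumberTheory.Automorphic.UnitaryGroup
open scoped Matrix Classical ComplexOrder

namespace Summit.HodgeConjecture.HodgeConjecture.R90.S5

open Summit.HodgeConjecture.HodgeConjecture.Cruxes.H413
open Summit.HodgeConjecture.HodgeConjecture.Cruxes.H413.F0P3InnerFormClassificationV6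
open Summit.HodgeConjecture.HodgeConjecture.Cruxes.H413.F0P3ClassTokenChoice (clFinChoice admUnitConstituents)
open Summit.HodgeConjecture.HodgeConjecture.Cruxes.H413.F0P3CohClassRoutingCot (RoutesAt)
open Summit.HodgeConjecture.HodgeConjecture.Cruxes.H413.F0P3FinComponentTokens (admUnitConstituents_nonempty_of_hasFinComponent)

variable (L : Type) [Field L] [NumberField L] [IsCMField L] (H : Matrix (Fin 3) (Fin 3) L)
  (hH : (H.map (cmConjRingHom L))ᵀ = H) (hHd : IsUnit H.det) (μω : HeckeCharacter L) (hμu : μω.IsUnitary)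
  [∀ v : HeightOneSpectrum (𝓞 ↥(maximalRealSubfield L)), MeasurableSpace (Gqs L v ⧸ Subgroup.center (Gqs L v))]
  (μZ : ∀ v : HeightOneSpectrum (𝓞 ↥(maximalRealSubfield L)), Measure (Gqs L v ⧸ Subgroup.center (Gqs L v)))
  (keys : ∀ (ξ : OneDimAutRepH L) (v : HeightOneSpectrum (𝓞 ↥(maximalRealSubfield L))),
    (∀ w : PlacesOver L v, IsCMField.complexConj L • w.1 = w.1) →
      {p : IrrClass (Gqs L v) × IrrClass (Gqs L v) //
        KeysCaseTwoLabels L v (μω.semilocalComponent L v) (torusLocalComponent L (IsCMField.complexConj L) v ξ.η)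
          (torusLocalComponent L (IsCMField.complexConj L) v ξ.ψ) p.1 p.2 ∧
        p.1.IsSquareIntegrable (μZ v) ∧ ¬ p.2.IsSquareIntegrable (μZ v)})
  (μ : Measure (Gp L H).automorphicQuotient) [(Gp L H).IsAutomorphicMeasure μ]

/-! ## §1 `ξ = ξ′` from routing to `ξ` off a finite set and membership in the `ξ′`-envelope -/

include μZ keys in
/-- **A DISCRETE `P` ROUTED BY `ξ` OFF A FINITE SET AND LYING IN THE `ξ′`-ENVELOPE HAS `ξ = ξ′`** (general inner form `U(H)`).  Hypotheses: `RoutesAt … P ξ v` for all finite `v ∉ S₁`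
(★); `MemXiFamily P … ξ′` (★); at every `v ∉ S₁`, `P` has an admissible unitarizable constituent (so that the chosen class is a constituent).  Proof: file 2 gives equal local components of
`η̃, η̃′` and `ψ̃, ψ̃′` at the definite witness above every split `v ∉ S₁`; file 1's wrapper ★ `OneDimAutRepH.ext_of_exists_bc_localComponent_eq_of_split_of_not_mem` concludes.
[cite: Rogawski1990, §13.1 p. 199; §13.3 Thm. 13.3.5 p. 202; §4.13 Lemma 4.13.1 (b)] [cite: Zelevinsky1980, Thm. 4.2] [cite: CasselsFrohlichANT1967, Ch. VII §4 Prop. 4.1] [cite: PlatonovRapinchuk1994, §7.3 Prop. 7.8] -/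
theorem xi_eq_of_routesAt_of_memXiFamily_of_not_mem (P : DiscreteAutomorphicRep (Gp L H) μ) (ξ ξ' : OneDimAutRepH L)
    (S₁ : Finset (HeightOneSpectrum (𝓞 ↥(maximalRealSubfield L))))
    (hroute : ∀ v : HeightOneSpectrum (𝓞 ↥(maximalRealSubfield L)), v ∉ S₁ → RoutesAt L H hH hHd μω hμu μZ keys μ P ξ v)
    (hmem : MemXiFamily P hH hHd μω hμu ξ')
    (hne : ∀ v : HeightOneSpectrum (𝓞 ↥(maximalRealSubfield L)), v ∉ S₁ → (admUnitConstituents P v).Nonempty) : ξ = ξ' :=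
  OneDimAutRepH.ext_of_exists_bc_localComponent_eq_of_split_of_not_mem S₁ fun v hv hs =>
    ⟨splitWitness v hs, bc_localComponent_eq_of_routesAt_of_memXiFamily L H hH hHd μω hμu μZ keys μ P ξ ξ' v hs (hroute v hv) hmem (hne v hv)⟩

include μZ keys in
/-- **The same for `P` with an irreducible ADMISSIBLE finite component `σ`** (★ `HasFinComponent`; the constituent supply is ★ `admUnitConstituents_nonempty_of_hasFinComponent`).
[cite: Rogawski1990, §13.1 p. 199; §13.3 Thm. 13.3.5 p. 202] [cite: FlathCorvallis1979, Thm. 3] [cite: CasselsFrohlichANT1967, Ch. VII §4 Prop. 4.1] -/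
theorem xi_eq_of_routesAt_of_memXiFamily_of_hasFinComponent (P : DiscreteAutomorphicRep (Gp L H) μ)
    {W : Type} [AddCommGroup W] [Module ℂ W] {σ : Representation ℂ (finAdelic (↥(maximalRealSubfield L)) L (IsCMField.complexConj L) 3 H) W}
    (hirr : σ.IsIrreducible) (hadm : σ.IsAdmissible) (hP : P.HasFinComponent σ) (ξ ξ' : OneDimAutRepH L)
    (S₁ : Finset (HeightOneSpectrum (𝓞 ↥(maximalRealSubfield L))))
    (hroute : ∀ v : HeightOneSpectrum (𝓞 ↥(maximalRealSubfield L)), v ∉ S₁ → RoutesAt L H hH hHd μω hμu μZ keys μ P ξ v)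
    (hmem : MemXiFamily P hH hHd μω hμu ξ') : ξ = ξ' :=
  xi_eq_of_routesAt_of_memXiFamily_of_not_mem L H hH hHd μω hμu μZ keys μ P ξ ξ' S₁ hroute hmem
    fun v _ => admUnitConstituents_nonempty_of_hasFinComponent L H P hirr hadm hP v

include μZ keys in
/-- **Cofinite-filter form** (`∀ᶠ v in cofinite, RoutesAt … P ξ v`) for `P` with an irreducible admissible finite component. [cite: Rogawski1990, §13.1 p. 199; §13.3 Thm. 13.3.5 p. 202] -/
theorem xi_eq_of_eventually_routesAt_of_memXiFamily_of_hasFinComponent (P : DiscreteAutomorphicRep (Gp L H) μ)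
    {W : Type} [AddCommGroup W] [Module ℂ W] {σ : Representation ℂ (finAdelic (↥(maximalRealSubfield L)) L (IsCMField.complexConj L) 3 H) W}
    (hirr : σ.IsIrreducible) (hadm : σ.IsAdmissible) (hP : P.HasFinComponent σ) (ξ ξ' : OneDimAutRepH L)
    (hroute : ∀ᶠ v : HeightOneSpectrum (𝓞 ↥(maximalRealSubfield L)) in cofinite, RoutesAt L H hH hHd μω hμu μZ keys μ P ξ v)
    (hmem : MemXiFamily P hH hHd μω hμu ξ') : ξ = ξ' := by
  have hfin : {v : HeightOneSpectrum (𝓞 ↥(maximalRealSubfield L)) | ¬ RoutesAt L H hH hHd μω hμu μZ keys μ P ξ v}.Finite :=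
    Filter.eventually_cofinite.1 hroute
  exact xi_eq_of_routesAt_of_memXiFamily_of_hasFinComponent L H hH hHd μω hμu μZ keys μ P hirr hadm hP ξ ξ' hfin.toFinset
    (fun v hv => by
      by_contra hne
      exact hv (hfin.mem_toFinset.2 hne)) hmem

/-! ## §2 (J-a″) THE FAMILY PIN: routing to `ξ` + the `ξ′`-envelope ⇒ the `ξ`-envelope -/

include μZ keys in
/-- **(J-a″) FAMILY PIN**: a discrete `P` of `U(H)` routed by `ξ` off a finite `S₁`, lying in the `ξ′`-envelope, with an admissible unitarizable constituent at every `v ∉ S₁`, lies in the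
`ξ`-ENVELOPE (`ξ = ξ′` by §1). [cite: Rogawski1990, §13.1 p. 199; §13.3 Thm. 13.3.5 p. 202] [cite: CasselsFrohlichANT1967, Ch. VII §4 Prop. 4.1] -/
theorem memXiFamily_of_routesAt_of_memXiFamily_of_not_mem (P : DiscreteAutomorphicRep (Gp L H) μ) (ξ ξ' : OneDimAutRepH L)
    (S₁ : Finset (HeightOneSpectrum (𝓞 ↥(maximalRealSubfield L))))
    (hroute : ∀ v : HeightOneSpectrum (𝓞 ↥(maximalRealSubfield L)), v ∉ S₁ → RoutesAt L H hH hHd μω hμu μZ keys μ P ξ v)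
    (hmem : MemXiFamily P hH hHd μω hμu ξ')
    (hne : ∀ v : HeightOneSpectrum (𝓞 ↥(maximalRealSubfield L)), v ∉ S₁ → (admUnitConstituents P v).Nonempty) :
    MemXiFamily P hH hHd μω hμu ξ := by
  rw [xi_eq_of_routesAt_of_memXiFamily_of_not_mem L H hH hHd μω hμu μZ keys μ P ξ ξ' S₁ hroute hmem hne]
  exact hmem

include μZ keys in
/-- **(J-a″) for `P` with an irreducible ADMISSIBLE finite component.** [cite: Rogawski1990, §13.1 p. 199; §13.3 Thm. 13.3.5 p. 202] [cite: FlathCorvallis1979, Thm. 3] -/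
theorem memXiFamily_of_routesAt_of_memXiFamily_of_hasFinComponent (P : DiscreteAutomorphicRep (Gp L H) μ)
    {W : Type} [AddCommGroup W] [Module ℂ W] {σ : Representation ℂ (finAdelic (↥(maximalRealSubfield L)) L (IsCMField.complexConj L) 3 H) W}
    (hirr : σ.IsIrreducible) (hadm : σ.IsAdmissible) (hP : P.HasFinComponent σ) (ξ ξ' : OneDimAutRepH L)
    (S₁ : Finset (HeightOneSpectrum (𝓞 ↥(maximalRealSubfield L))))
    (hroute : ∀ v : HeightOneSpectrum (𝓞 ↥(maximalRealSubfield L)), v ∉ S₁ → RoutesAt L H hH hHd μω hμu μZ keys μ P ξ v)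
    (hmem : MemXiFamily P hH hHd μω hμu ξ') : MemXiFamily P hH hHd μω hμu ξ := by
  rw [xi_eq_of_routesAt_of_memXiFamily_of_hasFinComponent L H hH hHd μω hμu μZ keys μ P hirr hadm hP ξ ξ' S₁ hroute hmem]
  exact hmem

/-! ## §3 The same under the frame's ONE binder `hAF : AutomorphicFlathAdmissible …` (dealer RULING (AFA-1)) -/

include μZ keys in
/-- **`ξ = ξ′` under `hAF : AutomorphicFlathAdmissible …`** (★ named frame predicate: every discrete `P` has an irreducible admissible finite component), cofinite routing.
[cite: FlathCorvallis1979, Thm. 3 and Thm. 4] [cite: Rogawski1990, §13.1 p. 199; §13.3 Thm. 13.3.5 p. 202] [cite: CasselsFrohlichANT1967, Ch. VII §4 Prop. 4.1] -/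
theorem xi_eq_of_routesAt_of_memXiFamily_of_automorphicFlathAdmissible
    (hAF : UnitaryGroup.AutomorphicFlathAdmissible (↥(maximalRealSubfield L)) L (IsCMField.complexConj L) 3 H μ)
    (P : DiscreteAutomorphicRep (Gp L H) μ) (ξ ξ' : OneDimAutRepH L) (S₁ : Finset (HeightOneSpectrum (𝓞 ↥(maximalRealSubfield L))))
    (hroute : ∀ v : HeightOneSpectrum (𝓞 ↥(maximalRealSubfield L)), v ∉ S₁ → RoutesAt L H hH hHd μω hμu μZ keys μ P ξ v)
    (hmem : MemXiFamily P hH hHd μω hμu ξ') : ξ = ξ' := by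
  obtain ⟨W, _, _, σ, hirr, hadm, hP⟩ := hAF P
  exact xi_eq_of_routesAt_of_memXiFamily_of_hasFinComponent L H hH hHd μω hμu μZ keys μ P hirr hadm hP ξ ξ' S₁ hroute hmem

include μZ keys in
/-- **(J-a″) FAMILY PIN under `hAF : AutomorphicFlathAdmissible …`**: a discrete `P` routed by `ξ` off a finite `S₁` and lying in the `ξ′`-envelope lies in the `ξ`-envelope.
[cite: FlathCorvallis1979, Thm. 3 and Thm. 4] [cite: Rogawski1990, §13.1 p. 199; §13.3 Thm. 13.3.5 p. 202] [cite: CasselsFrohlichANT1967, Ch. VII §4 Prop. 4.1] -/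
theorem memXiFamily_of_routesAt_of_memXiFamily_of_automorphicFlathAdmissible
    (hAF : UnitaryGroup.AutomorphicFlathAdmissible (↥(maximalRealSubfield L)) L (IsCMField.complexConj L) 3 H μ)
    (P : DiscreteAutomorphicRep (Gp L H) μ) (ξ ξ' : OneDimAutRepH L) (S₁ : Finset (HeightOneSpectrum (𝓞 ↥(maximalRealSubfield L))))
    (hroute : ∀ v : HeightOneSpectrum (𝓞 ↥(maximalRealSubfield L)), v ∉ S₁ → RoutesAt L H hH hHd μω hμu μZ keys μ P ξ v)
    (hmem : MemXiFamily P hH hHd μω hμu ξ') : MemXiFamily P hH hHd μω hμu ξ := by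
  rw [xi_eq_of_routesAt_of_memXiFamily_of_automorphicFlathAdmissible L H hH hHd μω hμu μZ keys μ hAF P ξ ξ' S₁ hroute hmem]
  exact hmem

include μZ keys in
/-- **(J-a″) cofinite-filter form under `hAF`**: `∀ᶠ v in cofinite, RoutesAt … P ξ v` and `MemXiFamily P … ξ′` ⇒ `MemXiFamily P … ξ`. [cite: Rogawski1990, §13.1 p. 199; §13.3 Thm. 13.3.5 p. 202] -/
theorem memXiFamily_of_eventually_routesAt_of_memXiFamily_of_automorphicFlathAdmissible
    (hAF : UnitaryGroup.AutomorphicFlathAdmissible (↥(maximalRealSubfield L)) L (IsCMField.complexConj L) 3 H μ)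
    (P : DiscreteAutomorphicRep (Gp L H) μ) (ξ ξ' : OneDimAutRepH L)
    (hroute : ∀ᶠ v : HeightOneSpectrum (𝓞 ↥(maximalRealSubfield L)) in cofinite, RoutesAt L H hH hHd μω hμu μZ keys μ P ξ v)
    (hmem : MemXiFamily P hH hHd μω hμu ξ') : MemXiFamily P hH hHd μω hμu ξ := by
  have hfin : {v : HeightOneSpectrum (𝓞 ↥(maximalRealSubfield L)) | ¬ RoutesAt L H hH hHd μω hμu μZ keys μ P ξ v}.Finite :=
    Filter.eventually_cofinite.1 hroute
  exact memXiFamily_of_routesAt_of_memXiFamily_of_automorphicFlathAdmissible L H hH hHd μω hμu μZ keys μ hAF P ξ ξ' hfin.toFinset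
    (fun v hv => by
      by_contra hne
      exact hv (hfin.mem_toFinset.2 hne)) hmem

end Summit.HodgeConjecture.HodgeConjecture.R90.S5

end
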